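import Summits.MatrixMultiplication.MatrixMultiplication.Theorems.SaturationLadderLevelTwoK5Word
import Literature.Computability.AlgebraicComplexity.RectangularExponentAlpha
import HarnessLib

/-!
# Level 2 of the saturation ladder at `ω(1,5,1)`: `ω(1,5,1) ≤ 401/65 = 6.16923…`
# (route `SaturationLadder`, node `TailDescentTwo`, lens 1 «grading / quantitative ladder», gen 22)

Cell `decomp-mm`, lens 1, gen 22 — fourth rung of the level-2 DEFECT LADDER `δ_k = ω(1,k,1) − k`
in proved currency (`δ₂ ≤ 0.2581`, `δ₃ ≤ 0.2106`, `δ₄ ≤ 0.1861` in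
`SaturationLadderLevelTwoK2/3/4`): **`ω(1,5,1) ≤ 401/65`**, i.e. `δ₅ ≤ 11/65 = 0.16924`
(`omegaRect_one_five_one_le_401_65`), beating descent from the `k = 4` rung (`223/43 + 1 = 6.1861`),
and the tail `ω(1,k,1) ≤ k + 76/65` for every real `k ≥ 5` (`omegaRect_one_mid_one_le_add_of_five`).  No named facts, no sorry, no
definitions (design and law in `SaturationLadderLevelTwoK5Word`, `q = 7` block lemmas and the
packing bound `R̃(CW_7^{⊗2}) ≤ 81` in `SaturationLadderLevelTwoKit7`).

THE PROOF.  `laserMethod_hasFormatValue_of_wordValue` on the valued word `lvl2Word` (`d = 2059`,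
`q = 7`, `91` copies of the `3 : 3 : 2` family block at `σ = 19/20`, NO letter `400`); the law is of
product form on the used support with empty row `I = 4`, so the penalty is `0` (zero-row lemma);
marginals `x : (1219, 564, 266, 10, 0)/2059`, `y = z : (58, 595, 1260, 144, 2)/2059`, `H_y ≤ H_x`
(`cert_marginals`); formats `A⁵ ≤ B` by `cert_format : 7^17563 ≤ 14^2000 · 51^7350`; packing
`2^{H_y} W A^{ω(1,5,1)} ≤ 81` and the final integer certificate
`cert_final : 2^164036 · 3^701018 · 5^120575 · 17^21833 ≤ 7^67494 · 29^130065 · 71^133835`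
(prime logarithms `ln 2059 = ln 29 + ln 71`, `ln 58`, `ln 595 = ln 5 + ln 7 + ln 17`,
`ln 1260 = 2 ln 2 + 2 ln 3 + ln 5 + ln 7`, `ln 144`, `ln 14`, `ln 51 = ln 3 + ln 17`, `ln 81`).
WHY `q = 7`: the cap `A^k ≤ B` of the `3 : 3 : 2` kernel at `q = 6` has `ln B / ln A → 4.92 < 5` at
its `k = 5` optimum (capped value `6.1785`); at `q = 7` the optimum is `6.16760` (uncapped) —
numerics gen22/design332.py, intsearch332.py, certs_k5.py: integer design `6.1687109`,
`ln B / ln A = 5.000093`, slack to `401/65`: `5.2e-4`, log-margin of `cert_final`: `36.7`.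
All certificates are `decide`d integer inequalities (kernel; `exponentiation.threshold 10⁶`).

## References

* F. Le Gall, *Faster algorithms for rectangular matrix multiplication*, FOCS 2012,
  arXiv:1204.1111, §3, §6.1, Prop. 6.2, Table 2. [LeGall2012]
* D. Coppersmith, S. Winograd, *Matrix multiplication via arithmetic progressions*,
  J. Symbolic Comput. 9 (1990), §8. [CoppersmithWinograd1990]
* D. Coppersmith, *Rectangular matrix multiplication revisited*, J. Complexity 13 (1997), §3.
  [Coppersmith1997]
* F. Le Gall, *Powers of tensors and fast matrix multiplication*, ISSAC 2014, arXiv:1401.7714,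
  Thm. 4.1 and Appendix A.3. [LeGall2014]
* F. Le Gall, F. Urrutia, *Improved rectangular matrix multiplication using powers of the
  Coppersmith–Winograd tensor*, SODA 2018, arXiv:1708.05622, Table 3. [LeGallUrrutia2018]
-/

set_option linter.dupNamespace false
set_option autoImplicit false
set_option exponentiation.threshold 1000000
set_option maxRecDepth 100000

noncomputable section

open Finset Real
open scoped BigOperators

namespace Summit.MatrixMultiplication.MatrixMultiplication.Theorems.SaturationLadderLevelTwoK5

open Literature.Computability.AlgebraicComplexity
open SaturationLadderLevelTwoKit (PL5 supp14)
open SaturationLadderLevelTwoKit7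
open SaturationLadderLevelTwo (append_mem repWord_mem const_mem fin5_lits negMulLog_div'
  log_two_mul_shannonEntropy_fin5)

/-! ## Marginal entropies -/

/-- **`ln 2 · H_x = ln 2059 − (1219 ln 1219 + 564 ln 564 + 266 ln 266 + 10 ln 10)/2059`.** [folklore] -/
theorem entropy₁_lvl2Law : Real.log 2 * shannonEntropy (marginalDist₁ lvl2Law) =
    Real.log 2059 - (1219 * Real.log 1219 + 564 * Real.log 564 + 266 * Real.log 266 +
      10 * Real.log 10) / 2059 := by
  obtain ⟨e0, e1, e2, e3, e4⟩ := marginalDist₁_lvl2Law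
  rw [log_two_mul_shannonEntropy_fin5, e0, e1, e2, e3, e4,
    negMulLog_div' (by norm_num) (by norm_num), negMulLog_div' (by norm_num) (by norm_num),
    negMulLog_div' (by norm_num) (by norm_num), negMulLog_div' (by norm_num) (by norm_num),
    Real.negMulLog_zero]
  ring

/-- **`ln 2 · H_y = ln 2059 − (58 ln 58 + 595 ln 595 + 1260 ln 1260 + 144 ln 144 + 2 ln 2)/2059`.**
[folklore] -/
theorem entropy₂_lvl2Law : Real.log 2 * shannonEntropy (marginalDist₂ lvl2Law) =
    Real.log 2059 - (58 * Real.log 58 + 595 * Real.log 595 + 1260 * Real.log 1260 +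
      144 * Real.log 144 + 2 * Real.log 2) / 2059 := by
  obtain ⟨e0, e1, e2, e3, e4⟩ := marginalDist₂_lvl2Law
  rw [log_two_mul_shannonEntropy_fin5, e0, e1, e2, e3, e4,
    negMulLog_div' (by norm_num) (by norm_num), negMulLog_div' (by norm_num) (by norm_num),
    negMulLog_div' (by norm_num) (by norm_num), negMulLog_div' (by norm_num) (by norm_num),
    negMulLog_div' (by norm_num) (by norm_num)]
  ring

/-- `ln 2 · H_z = ln 2 · H_y`. [folklore] -/
theorem entropy₃_lvl2Law : Real.log 2 * shannonEntropy (marginalDist₃ lvl2Law) =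
    Real.log 2059 - (58 * Real.log 58 + 595 * Real.log 595 + 1260 * Real.log 1260 +
      144 * Real.log 144 + 2 * Real.log 2) / 2059 := by
  obtain ⟨e0, e1, e2, e3, e4⟩ := marginalDist₃_lvl2Law
  rw [log_two_mul_shannonEntropy_fin5, e0, e1, e2, e3, e4,
    negMulLog_div' (by norm_num) (by norm_num), negMulLog_div' (by norm_num) (by norm_num),
    negMulLog_div' (by norm_num) (by norm_num), negMulLog_div' (by norm_num) (by norm_num),
    negMulLog_div' (by norm_num) (by norm_num)]
  ring

/-- Integer certificate: `∏ u_x^{u_x} ≤ ∏ u_y^{u_y}` (`H_y ≤ H_x`). [folklore] -/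
theorem cert_marginals :
    (1219 : ℕ) ^ 1219 * 564 ^ 564 * 266 ^ 266 * 10 ^ 10 ≤
      58 ^ 58 * 595 ^ 595 * 1260 ^ 1260 * 144 ^ 144 * 2 ^ 2 := by
  decide

/-! ## The certificates and the conclusion -/

/-- Integer certificate: `7^17563 ≤ 14^2000 · 51^7350` (`A⁵ ≤ B` for the per-position formats).
[folklore] -/
theorem cert_format : (7 : ℕ) ^ 17563 ≤ 14 ^ 2000 * 51 ^ 7350 := by
  decide

/-- Integer certificate of the final inequality `65 (ln 81 − H_y ln 2 − ln W) ≤ 401 ln A`: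
`2^164036 · 3^701018 · 5^120575 · 17^21833 ≤ 7^67494 · 29^130065 · 71^133835`. [folklore] -/
theorem cert_final :
    (2 : ℕ) ^ 164036 * 3 ^ 701018 * 5 ^ 120575 * 17 ^ 21833 ≤
      7 ^ 67494 * 29 ^ 130065 * 71 ^ 133835 := by
  decide

/-- **Level 2 of the saturation ladder at `ω(1,5,1)` (the `k = 5` instance of the hypothesis of the
node `TailDescentTwo`): `ω(1,5,1) ≤ 401/65`** (Le Gall 2012 §6 at `q = 7` in the tree's currency,
with the `3 : 3 : 2` family block at `σ = 19/20` and the explicit design `lvl2Word`).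
[cite: LeGall2012, §6.1, Prop. 6.2 and Table 2] [cite: CoppersmithWinograd1990, §8]
[cite: Coppersmith1997, §3] -/
theorem omegaRect_one_five_one_le_401_65 : omegaRect ℂ 1 5 1 ≤ 401 / 65 := by
  -- the minimum marginal entropy is `H_y` (folded in: `H_y ≤ H_x`, `H_z = H_y`)
  have entropy₂_le_entropy₁ :
      shannonEntropy (marginalDist₂ lvl2Law) ≤ shannonEntropy (marginalDist₁ lvl2Law) := by
    have hlog : 0 < Real.log 2 := Real.log_pos one_lt_two
    have h : ((1219 : ℕ) ^ 1219 * 564 ^ 564 * 266 ^ 266 * 10 ^ 10 : ℝ) ≤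
        (58 : ℕ) ^ 58 * 595 ^ 595 * 1260 ^ 1260 * 144 ^ 144 * 2 ^ 2 := by
      exact_mod_cast cert_marginals
    push_cast at h
    have h' := Real.log_le_log (by positivity) h
    rw [Real.log_mul (by positivity) (by positivity), Real.log_mul (by positivity) (by positivity),
      Real.log_mul (by positivity) (by positivity), Real.log_mul (by positivity) (by positivity),
      Real.log_mul (by positivity) (by positivity), Real.log_mul (by positivity) (by positivity),
      Real.log_mul (by positivity) (by positivity)] at h'
    simp only [Real.log_pow, Nat.cast_ofNat] at h'
    have e1 := entropy₁_lvl2Law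
    have e2 := entropy₂_lvl2Law
    have key : Real.log 2 * shannonEntropy (marginalDist₂ lvl2Law) ≤
        Real.log 2 * shannonEntropy (marginalDist₁ lvl2Law) := by
      rw [e1, e2]
      linarith [h']
    exact le_of_mul_le_mul_left key hlog
  have entropy₃_eq_entropy₂ :
      shannonEntropy (marginalDist₃ lvl2Law) = shannonEntropy (marginalDist₂ lvl2Law) := by
    have hlog : Real.log 2 ≠ 0 := (Real.log_pos one_lt_two).ne'
    have e := entropy₃_lvl2Law
    rw [← entropy₂_lvl2Law] at e
    exact mul_left_cancel₀ hlog e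
  have min_entropy_lvl2Law :
      min (shannonEntropy (marginalDist₁ lvl2Law)) (min (shannonEntropy (marginalDist₂ lvl2Law))
        (shannonEntropy (marginalDist₃ lvl2Law))) = shannonEntropy (marginalDist₂ lvl2Law) := by
    rw [entropy₃_eq_entropy₂, min_self]
    exact min_eq_right entropy₂_le_entropy₁
  -- per-position value and formats: the `2059`-th roots of the totals
  set W : ℝ := Vtot ^ (((2059 : ℕ) : ℝ)⁻¹) with hWdef
  set A : ℝ := Xtot ^ (((2059 : ℕ) : ℝ)⁻¹) with hAdef
  set B : ℝ := Ytot ^ (((2059 : ℕ) : ℝ)⁻¹) with hBdef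
  have hW0 : 0 < W := Real.rpow_pos_of_pos Vtot_pos _
  have hA0 : 0 < A := Real.rpow_pos_of_pos Xtot_pos _
  have hB0 : 0 < B := Real.rpow_pos_of_pos Ytot_pos _
  have hWd : W ^ 2059 = Vtot := Real.rpow_inv_natCast_pow Vtot_pos.le (by norm_num)
  have hAd : A ^ 2059 = Xtot := Real.rpow_inv_natCast_pow Xtot_pos.le (by norm_num)
  have hBd : B ^ 2059 = Ytot := Real.rpow_inv_natCast_pow Ytot_pos.le (by norm_num)
  have hblk : HasFormatValue (blockOf7 lvl2Word) (W ^ 2059) (A ^ 2059) (B ^ 2059) (A ^ 2059) := by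
    rw [hWd, hAd, hBd]; exact hasFormatValue_lvl2Word
  -- the laser method on the valued word
  have hT := laserMethod_hasFormatValue_of_wordValue (bigCwSq ℂ 7) cwLev2 cwLev2 cwLev2
    cwSupport₂ (bigCwSq_cwSupport₂ ℂ 7) cwTight₂ cwTight₂ cwTight₂γ cwTight₂_injective
    cwTight₂_injective cwTight₂γ_injective cwTight₂_bound cwTight₂_bound cwTight₂_sum
    (by norm_num : 0 < 2059) lvl2Word lvl2Word_mem lvl2Law lvl2Law_eq hW0 hA0.le hB0.le hA0.le
    hblk
  rw [maxEntropyPenalty_lvl2Law, sub_zero, min_entropy_lvl2Law] at hT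
  -- logarithms of the roots
  have hlogW : Real.log W = (2059 : ℝ)⁻¹ * (91 * (6 * Real.log 2)) := by
    rw [hWdef, Real.log_rpow Vtot_pos, Vtot, one_mul, Real.log_pow,
      Real.log_rpow (by norm_num : (0 : ℝ) < 2)]
    push_cast; ring
  have hlogA : Real.log A = (2059 : ℝ)⁻¹ *
      (14 * Real.log 14 + 42 * Real.log 51 + 91 * (5 * Real.log 7)) := by
    rw [hAdef, Real.log_rpow Xtot_pos, Xtot, Real.log_mul (by positivity) (by positivity),
      Real.log_mul (by positivity) (by positivity), Real.log_pow, Real.log_pow, Real.log_pow,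
      Real.log_rpow (by norm_num : (0 : ℝ) < 7)]
    push_cast; ring
  have hlogB : Real.log B = (2059 : ℝ)⁻¹ *
      (270 * Real.log 14 + 945 * Real.log 51 + 91 * (57 / 10 * Real.log 7)) := by
    rw [hBdef, Real.log_rpow Ytot_pos, Ytot, Real.log_mul (by positivity) (by positivity),
      Real.log_mul (by positivity) (by positivity), Real.log_pow, Real.log_pow, Real.log_pow,
      Real.log_rpow (by norm_num : (0 : ℝ) < 7)]
    push_cast; ring
  have l14 : Real.log 14 = Real.log 2 + Real.log 7 := by
    rw [show (14 : ℝ) = 2 * 7 by norm_num, Real.log_mul (by norm_num) (by norm_num)]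
  have l51 : Real.log 51 = Real.log 3 + Real.log 17 := by
    rw [show (51 : ℝ) = 3 * 17 by norm_num, Real.log_mul (by norm_num) (by norm_num)]
  have l81 : Real.log 81 = 4 * Real.log 3 := by
    rw [show (81 : ℝ) = 3 ^ 4 by norm_num, Real.log_pow]; push_cast; ring
  have l2059 : Real.log 2059 = Real.log 29 + Real.log 71 := by
    rw [show (2059 : ℝ) = 29 * 71 by norm_num, Real.log_mul (by norm_num) (by norm_num)]
  have l58 : Real.log 58 = Real.log 2 + Real.log 29 := by
    rw [show (58 : ℝ) = 2 * 29 by norm_num, Real.log_mul (by norm_num) (by norm_num)]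
  have l595 : Real.log 595 = Real.log 5 + Real.log 7 + Real.log 17 := by
    rw [show (595 : ℝ) = 5 * 7 * 17 by norm_num, Real.log_mul (by norm_num) (by norm_num),
      Real.log_mul (by norm_num) (by norm_num)]
  have l1260 : Real.log 1260 = 2 * Real.log 2 + 2 * Real.log 3 + Real.log 5 + Real.log 7 := by
    rw [show (1260 : ℝ) = 2 ^ 2 * 3 ^ 2 * 5 * 7 by norm_num,
      Real.log_mul (by norm_num) (by norm_num), Real.log_mul (by norm_num) (by norm_num),
      Real.log_mul (by norm_num) (by norm_num), Real.log_pow, Real.log_pow]; push_cast; ring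
  have l144 : Real.log 144 = 4 * Real.log 2 + 2 * Real.log 3 := by
    rw [show (144 : ℝ) = 2 ^ 4 * 3 ^ 2 by norm_num, Real.log_mul (by norm_num) (by norm_num),
      Real.log_pow, Real.log_pow]; push_cast; ring
  -- (1) `A > 1`
  have hX1 : 1 < Xtot := by
    unfold Xtot
    have h1 : (1 : ℝ) < 14 ^ 14 * 51 ^ 42 := by norm_num
    have h2 : (1 : ℝ) ≤ ((7 : ℝ) ^ (5 : ℝ)) ^ 91 :=
      one_le_pow₀ (Real.one_le_rpow (by norm_num) (by norm_num))
    exact one_lt_mul_of_lt_of_le h1 h2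
  have hA1 : 1 < A := Real.one_lt_rpow hX1 (by positivity)
  have hlA : 0 < Real.log A := Real.log_pos hA1
  -- (2) the format inequality `A⁵ ≤ B`
  have hAB : A ^ (5 : ℝ) ≤ B := by
    rw [← Real.log_le_log_iff (Real.rpow_pos_of_pos hA0 _) hB0, Real.log_rpow hA0, hlogA, hlogB]
    have hc : ((7 : ℕ) ^ 17563 : ℝ) ≤ (14 : ℕ) ^ 2000 * (51 : ℕ) ^ 7350 := by
      exact_mod_cast cert_format
    push_cast at hc
    have hc' := Real.log_le_log (by positivity) hc
    rw [Real.log_mul (by positivity) (by positivity)] at hc'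
    simp only [Real.log_pow, Nat.cast_ofNat] at hc'
    linarith
  -- (3) the packing bound `2^{H_y} W A^{ω(1,5,1)} ≤ R̃(CW_7^{⊗2}) ≤ 81`, in logarithms
  have hmain := mul_rpow_omegaRect_le_asymptoticRank_of_hasFormatValue hT hA1 (by norm_num) hAB
  have h81 := hmain.trans asymptoticRank_bigCwSq_seven_le
  have hpos : 0 < (2 : ℝ) ^ shannonEntropy (marginalDist₂ lvl2Law) * W * A ^ omegaRect ℂ 1 5 1 := by
    positivity
  have hlog := Real.log_le_log hpos h81
  rw [Real.log_mul (by positivity) (by positivity), Real.log_mul (by positivity) (by positivity),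
    Real.log_rpow (by norm_num : (0 : ℝ) < 2), Real.log_rpow hA0] at hlog
  -- (4) the final certificate: `ln 81 − H_y ln 2 − ln W ≤ (401/65) ln A`
  have e2 := entropy₂_lvl2Law
  rw [l2059, l58, l595, l1260, l144] at e2
  have hc : ((2 : ℕ) ^ 164036 * (3 : ℕ) ^ 701018 * (5 : ℕ) ^ 120575 * (17 : ℕ) ^ 21833 : ℝ) ≤
      (7 : ℕ) ^ 67494 * (29 : ℕ) ^ 130065 * (71 : ℕ) ^ 133835 := by
    exact_mod_cast cert_final
  push_cast at hc
  have hc' := Real.log_le_log (by positivity) hc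
  rw [Real.log_mul (by positivity) (by positivity), Real.log_mul (by positivity) (by positivity),
    Real.log_mul (by positivity) (by positivity), Real.log_mul (by positivity) (by positivity),
    Real.log_mul (by positivity) (by positivity)] at hc'
  simp only [Real.log_pow, Nat.cast_ofNat] at hc'
  have hfin : Real.log 81 - shannonEntropy (marginalDist₂ lvl2Law) * Real.log 2 - Real.log W ≤
      401 / 65 * Real.log A := by
    rw [hlogW, hlogA, l81, l14, l51]
    linarith
  have key : omegaRect ℂ 1 5 1 * Real.log A ≤ 401 / 65 * Real.log A := by linarith
  exact le_of_mul_le_mul_right key hlA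

/-- **`ω(1,5,1) < 6.1693`.** [cite: LeGall2012, §6.1] -/
theorem omegaRect_one_five_one_lt_6_1693 : omegaRect ℂ 1 5 1 < 6.1693 :=
  lt_of_le_of_lt omegaRect_one_five_one_le_401_65 (by norm_num)

/-- **The `k = 5` rung beats descent from the `k = 4` rung** (`223/43 + 1 = 266/43 = 6.1860…`,
`SaturationLadderLevelTwoK4.omegaRect_one_mid_one_le_add_of_four`). [cite: LeGall2012, §6.1] -/
theorem omegaRect_one_five_one_lt_descent : omegaRect ℂ 1 5 1 < 266 / 43 :=
  lt_of_le_of_lt omegaRect_one_five_one_le_401_65 (by norm_num)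

/-- The remaining gap of the rung to `ω(1,5,1) = 6` (the `k = 5` instance of the hypothesis of
`TailDescentTwo`) is `< 0.1693`: the level-2 defect ladder reads `0.2581 (k=2) > 0.2106 (k=3) >
0.1861 (k=4) > 0.1693 (k=5)`. [cite: LeGall2012, §6.1] -/
theorem omegaRect_one_five_one_sub_six_lt : omegaRect ℂ 1 5 1 - 6 < 0.1693 := by
  have := omegaRect_one_five_one_le_401_65; norm_num at this ⊢; linarith

/-- **Descent to the tail**: `ω(1,k,1) ≤ k + 76/65` for every real `k ≥ 5`
(`omegaRect_one_mid_one_le_add`). [cite: Coppersmith1997, §3] -/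
theorem omegaRect_one_mid_one_le_add_of_five (k : ℝ) (hk : 5 ≤ k) :
    omegaRect ℂ 1 k 1 ≤ k + 76 / 65 := by
  have h := omegaRect_one_mid_one_le_add (K := ℂ) hk
  have h5 := omegaRect_one_five_one_le_401_65
  norm_num at h h5 ⊢
  linarith

end Summit.MatrixMultiplication.MatrixMultiplication.Theorems.SaturationLadderLevelTwoK5

end
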